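import Literature.IUT.HodgeTheaters.PuncturedEllipticCoveringsArrowClaimsOfLawsCyclic
import Literature.IUT.HodgeTheaters.PuncturedEllipticCoveringsModLCuspLaws
import Literature.IUT.HodgeTheaters.InitialThetaData
import HarnessLib

/-!
# [IUTchI] §1 p. 38 — `ArrowCoveringClaims` FROM `ModLCuspLaws`: the printed claims DERIVED (assembly)

Mochizuki, *Inter-universal Teichmüller theory I*, kurims manuscript (May 2020), §1 pp. 37–38
[cite: Mochizuki2012, IUTchI §1 pp.37-38] (D-0012 claim key, status disputed).  PROOF-ONLY; file B6 (assembly)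
of the «hA re-grounding» series (abc-iut-L5-lead RULINGS #58 (10) GO).  No `def`, no instance, no new `Prop`
fact; the frozen files `PuncturedEllipticCoverings.lean` (p404449) / `…Cusps.lean` (p424023) are untouched.

RESULT.  The thirteen printed claims of p. 38 about the §1 construction — typed as
`PuncturedEllipticData.ArrowCoveringClaims` and carried so far as the standing binder `hA` of the Layer-5
certificate (every (β)/D13 statement, Cor. 1.2's assembly) — are a THEOREM of:
* the cusp action `CuspGalois` (p424023; [IUTchI] §1 p. 37, [EtTh] Def. 2.1 / Rmk. 2.1.1);
* the six `Δ_ε`-level laws `ModLCuspLaws` (p446054; print p. 37 l. 30 – p. 38 l. 24: `Δ_X̲^{ab} ⊗ ℤ/l` finite,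
  cusp inertia procyclic, "`I_ε′ ≅ ℤ/lℤ`", "`0 → I_ε′ × I_ε″ → Δ_ε`", "`ι` acts on `Δ_E ⊗ ℤ/l` via `−1`", and
  `μ_l ⊆ k` — the last a consequence of (∗) via the Weil pairing, NOT a sentence of print);
* the existence of a GEOMETRIC representative of `Gal(X̲/C̲)`: `∃ ι̲ ∈ Δ_C̲ ∖ Δ_X̲` — at an initial Θ-datum a
  theorem of abc-iut-L5-t2's `ThetaGeometry` (`not_PiCbar_le_PiX`, `aug_PiXbar`), see
  `InitialThetaData.arrowCoveringClaims_pe_of_modLCuspLaws`.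
Clause by clause: `jKer_normal`, `inertia_ε1_sup`, `inertia_ε2_sup` (B1 p444784) · `jKer_relindex` (B2 p445944) ·
`piXarrow_inf_delta`, `piXarrow_normal`, `piCarrow_normal` (B3 p447007) · `piXarrow_relindex`,
`piCarrow_relindex`, `cartesian` (B4) · `galX_cyclic`, `galC_cyclic` (B5) · `aug_piXarrow` (p407891, law-free).

CERT EFFECT (booked by the Layer-5 certificate writer, not here): the binder `hA : D.geom.pe.ArrowCoveringClaims`
can be replaced BY NAME by `(C : D.geom.pe.CuspGalois) (h : D.geom.pe.ModLCuspLaws)` through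
`InitialThetaData.arrowCoveringClaims_pe_of_modLCuspLaws` — thirteen claims about Mochizuki's construction traded
for six classical-shaped laws about the standard objects `I_x`, `Δ_X̲^{ab} ⊗ ℤ/l`, `Δ_ε`.

HONEST FRAMING: nothing here asserts abc proved or refuted or takes a side on [IUTchIII] Cor. 3.12; the result is
an IMPLICATION between named hypothesis binders (laws ⇒ claims), not a discharge of either at the genuine datum;
typed ≠ inhabited ≠ discharged.
-/

namespace Literature.IUT.HodgeTheaters

namespace PuncturedEllipticData

open scoped Pointwise
open Topology Literature.AnabelianGeometry.AbsoluteAnabelian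

universe u

variable {D : PuncturedEllipticData.{u}}

/-- A GEOMETRIC representative of `Gal(X̲/C̲)`: if `Π_C̲ ⊄ Π_X` and `Π_X̲ ↠ G_k`, some `ι̲ ∈ Δ_C̲` lies outside `Δ_X̲`
(multiply any `c ∈ Π_C̲ ∖ Π_X` by an element of `Π_X̲` with the same image in `G_k`).
([IUTchI] §1 p.37) [claim: Mochizuki2012, status: disputed] -/
theorem exists_mem_deltaCbar_not_mem_deltaXbar (hCX : ¬ D.PiCbar ≤ D.PiX)
    (haug : Function.Surjective (D.E.aug.toMonoidHom.comp D.PiXbar.subtype)) :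
    ∃ c ∈ D.DeltaCbar, c ∉ D.DeltaXbar := by
  obtain ⟨c₀, hc₀, hc₀X⟩ := SetLike.not_le_iff_exists.mp hCX
  obtain ⟨s, hs⟩ := haug (D.E.aug c₀)
  have hs' : D.E.aug (s : D.PiC) = D.E.aug c₀ := hs
  refine ⟨c₀ * (s : D.PiC)⁻¹, ⟨D.PiCbar.mul_mem hc₀ (D.PiCbar.inv_mem s.2.2), ?_⟩, ?_⟩
  · change c₀ * (s : D.PiC)⁻¹ ∈ D.E.geom
    rw [D.E.mem_geom, map_mul, map_inv, hs', mul_inv_cancel]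
  · intro h
    apply hc₀X
    have := D.PiX.mul_mem h.1.1 s.2.1
    simpa only [inv_mul_cancel_right] using this

namespace CuspGalois

variable (C : D.CuspGalois)

include C in
/-- **[IUTchI] §1 p. 38 — ALL the printed claims `ArrowCoveringClaims` DERIVED from the `Δ_ε`-level laws
`ModLCuspLaws`, the cusp action, and a geometric representative of `Gal(X̲/C̲)`.**
([IUTchI] §1 p.38) [claim: Mochizuki2012, status: disputed] -/
theorem arrowCoveringClaims_of_modLCuspLaws (h : D.ModLCuspLaws) (hι : ∃ c ∈ D.DeltaCbar, c ∉ D.DeltaXbar) :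
    D.ArrowCoveringClaims where
  jKer_normal := C.jKer_normal_of_inertiaCentral h.inertia_central
  jKer_relindex := C.jKer_relindex_of_laws h.modLKer_relIndex_ne_zero (h.inertia_procyclic D.ε1)
    h.inertia_ε1_image_order h.inertia_images_inf_le h.inertia_central h.iota_neg hι
  inertia_ε1_sup := C.inertia_ε1_sup_of_laws h.inertia_central h.iota_neg hι
  inertia_ε2_sup := C.inertia_ε2_sup_of_laws h.inertia_central h.iota_neg hι
  piXarrow_inf_delta := C.piXarrow_inf_deltaC_of_inertiaCentral h.inertia_central
  aug_piXarrow := D.aug_piXarrow_surjective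
  cartesian := C.cartesian_of_laws h.inertia_central hι
  piXarrow_normal := C.piXarrow_normal_of_laws h.inertia_central h.iota_neg hι
  piCarrow_normal := C.piCarrow_normal_of_laws h.inertia_central h.iota_neg hι
  piXarrow_relindex := C.piXarrow_relindex_of_laws h.modLKer_relIndex_ne_zero (h.inertia_procyclic D.ε1)
    h.inertia_ε1_image_order h.inertia_images_inf_le h.inertia_central h.iota_neg hι
  piCarrow_relindex := C.piCarrow_relindex_of_laws h.modLKer_relIndex_ne_zero (h.inertia_procyclic D.ε1)
    h.inertia_ε1_image_order h.inertia_images_inf_le h.inertia_central h.iota_neg hι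
  galX_cyclic := C.galX_cyclic_of_laws h.modLKer_relIndex_ne_zero (h.inertia_procyclic D.ε1)
    h.inertia_ε1_image_order h.inertia_images_inf_le h.inertia_central h.iota_neg hι
  galC_cyclic := C.galC_cyclic_of_laws h.modLKer_relIndex_ne_zero (h.inertia_procyclic D.ε1)
    h.inertia_ε1_image_order h.inertia_images_inf_le h.inertia_central h.iota_neg hι

include C in
/-- The same with the geometric representative supplied from `Π_C̲ ⊄ Π_X` and `Π_X̲ ↠ G_k` (the two laws of
abc-iut-L5-t2's `ThetaGeometry`). ([IUTchI] §1 p.38) [claim: Mochizuki2012, status: disputed] -/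
theorem arrowCoveringClaims_of_modLCuspLaws' (h : D.ModLCuspLaws) (hCX : ¬ D.PiCbar ≤ D.PiX)
    (haug : Function.Surjective (D.E.aug.toMonoidHom.comp D.PiXbar.subtype)) : D.ArrowCoveringClaims :=
  C.arrowCoveringClaims_of_modLCuspLaws h (D.exists_mem_deltaCbar_not_mem_deltaXbar hCX haug)

end CuspGalois

/-- Equivalent packaging: `Nonempty CuspGalois → ModLCuspLaws → (∃ ι̲) → ArrowCoveringClaims`.
([IUTchI] §1 p.38) [claim: Mochizuki2012, status: disputed] -/
theorem arrowCoveringClaims_of_modLCuspLaws (hC : Nonempty D.CuspGalois) (h : D.ModLCuspLaws)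
    (hι : ∃ c ∈ D.DeltaCbar, c ∉ D.DeltaXbar) : D.ArrowCoveringClaims :=
  hC.some.arrowCoveringClaims_of_modLCuspLaws h hι

end PuncturedEllipticData

/-! ### At an initial Θ-datum: the binder `hA` of the Layer-5 certificate from `CuspGalois` + `ModLCuspLaws` -/

namespace InitialThetaData

universe u' v w

variable {F : Type u'} {K : Type v} {Fbar : Type w} [Field F] [NumberField F] [Field K] [NumberField K]
  [Algebra F K] [Field Fbar] [Algebra F Fbar] [Algebra K Fbar]
  {E : WeierstrassCurve F} [E.IsElliptic] {l : ℕ} {Pb : BadPlacePredicates K}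
  (D : InitialThetaData F K Fbar E l Pb)

/-- **The Layer-5 certificate binder `hA : D.geom.pe.ArrowCoveringClaims` RE-GROUNDED**: at an initial Θ-datum
(Def. 3.1), the printed §1 claims about `Π_{X̲→_K} ⊆ Π_{C̲→_K}` follow from the cusp action `CuspGalois` and the
six `Δ_ε`-level laws `ModLCuspLaws` — the geometric representative of `Gal(X̲_K/C̲_K)` exists by Def. 3.1 (d)
(`ThetaGeometry.not_PiCbar_le_PiX`, `ThetaGeometry.aug_PiXbar`). ([IUTchI] Def 3.1 (d) p.62, §1 p.38)
[claim: Mochizuki2012, status: disputed] -/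
theorem arrowCoveringClaims_pe_of_modLCuspLaws (C : D.geom.pe.CuspGalois) (h : D.geom.pe.ModLCuspLaws) :
    D.geom.pe.ArrowCoveringClaims :=
  C.arrowCoveringClaims_of_modLCuspLaws' h D.geom.not_PiCbar_le_PiX D.geom.aug_PiXbar

end InitialThetaData

end Literature.IUT.HodgeTheaters
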